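import Summits.CriticalPhenomena.CardyFormulaZ2.Theorems.CardyAnchoredRigiditySubseqCardyStubCountableApprox
import Summits.CriticalPhenomena.CardyFormulaZ2.Theorems.CardyAnchoredRigiditySubseqCardyReduction

/-!
# Joint subsequential limits of the bond-`ℤ²` crossing probabilities of ALL conformal rectangles
# (crux `SubseqCardy`, stmt-CriticalPhenomena-5768, line `registered`: step S1, unconditional)

Route `CardyAnchoredRigidity` (decl shared with `CardyLocalRigidity`), sub-problem `CardyFormulaZ2`.
With S1a `stub_diagonalCauchy` and S1b `stub_countableApprox` both landed, the tightness step S1 of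
the line is a theorem, recorded here in its two useful forms:

* `jointSubseqLimit` (registered sub-goal) — there is ONE sequence of meshes `u n → 0⁺` along which
  `bondDomainCrossingProb R (u n)` converges for EVERY conformal rectangle `R` (bounded Jordan domain
  with four marked boundary points, however wild its boundary);
* `exists_strictMono_jointLimit` — **precompactness**: EVERY sequence of meshes tending to `0⁺` has a
  subsequence with this property (the existence half of the target `SubseqConformalInvariance`,
  stmt-CriticalPhenomena-8266; what remains of that target is exactly the registered stub S2
  `stub_limitConformal`: every joint sequential limit factors through the conformal modulus).

Inputs (all proved in the tree): Cantor's diagonal over a countable family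
(`Literature.Analysis.FunctionSpaces.exists_strictMono_forall_tendsto_real`) and the `ε/3` Cauchy
argument (`exists_tendsto_comp_of_forall_approx`); countable uniform approximability of the crossing
functions (`stub_countableApprox`: separability of the plane homeomorphisms for compact convergence,
Schramm–Smirnov 2011 Lemma 5.1 domain perturbation for crude crossings `stub_DomainPerturbation`, and
the bond ≈ crude sandwich `stub_bondNearCrude`).

References: O. Schramm, S. Smirnov, Ann. Probab. 39 (2011) §1.3, §5; M. Aizenman, A. Burchard,
Duke Math. J. 99 (1999) (tightness folklore); G. Grimmett, *Percolation* (1999) §11.7.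
-/

namespace Summit.CriticalPhenomena.CardyFormulaZ2.Cruxes.SubseqCardy.Birth

open Filter Topology

/-- **Joint subsequential limit of the bond-`ℤ²` crossing probabilities (S1 of line `registered`,
PROVED).** There is one sequence of meshes `u n → 0⁺` along which, for EVERY conformal rectangle
`R`, the `P_{1/2}` crossing probabilities `bondDomainCrossingProb R (u n)` converge. (S1a
`stub_diagonalCauchy` applied to S1b `stub_countableApprox`.) [folklore] -/
theorem jointSubseqLimit : ∃ u : ℕ → ℝ, Filter.Tendsto u Filter.atTop (nhdsWithin (0 : ℝ) (Set.Ioi 0)) ∧ ∃ g : Literature.Probability.RandomPlanarGeometry.ConformalRectangle → ℝ, ∀ R : Literature.Probability.RandomPlanarGeometry.ConformalRectangle, Filter.Tendsto (fun n => Literature.Probability.Percolation.bondDomainCrossingProb R (u n)) Filter.atTop (nhds (g R)) :=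
  stub_diagonalCauchy stub_countableApprox

/-- **Precompactness of the bond-`ℤ²` crossing functions (PROVED).** Every sequence of meshes
`u n → 0⁺` has a subsequence `u ∘ φ` along which, for EVERY conformal rectangle `R`, the crossing
probabilities `bondDomainCrossingProb R (u (φ n))` converge — the existence half of the target
`SubseqConformalInvariance` (stmt-CriticalPhenomena-8266).
(`exists_strictMono_jointLimit_of_countableApprox` applied to `stub_countableApprox`.) [folklore] -/
theorem exists_strictMono_jointLimit (u : ℕ → ℝ)
    (hu : Filter.Tendsto u Filter.atTop (nhdsWithin (0 : ℝ) (Set.Ioi 0))) :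
    ∃ φ : ℕ → ℕ, StrictMono φ ∧
      ∃ g : Literature.Probability.RandomPlanarGeometry.ConformalRectangle → ℝ,
        ∀ R : Literature.Probability.RandomPlanarGeometry.ConformalRectangle,
          Filter.Tendsto
            (fun n => Literature.Probability.Percolation.bondDomainCrossingProb R (u (φ n)))
            Filter.atTop (nhds (g R)) :=
  exists_strictMono_jointLimit_of_countableApprox stub_countableApprox u hu

/-- **What remains of X_M is exactly S2.** With precompactness proved, the open target
`CardyMirrorMonotone.SubseqConformalInvariance` (stmt-CriticalPhenomena-8266) is EQUIVALENT to the
registered stub S2 `stub_limitConformal` of this line (every joint sequential limit of the crossing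
probabilities factors through the conformal modulus). [folklore] -/
theorem subseqConformalInvariance_iff_stub_limitConformal :
    Summit.CriticalPhenomena.CardyFormulaZ2.Theses.CardyMirrorMonotone.SubseqConformalInvariance ↔
      (∀ u : ℕ → ℝ, Filter.Tendsto u Filter.atTop (nhdsWithin (0 : ℝ) (Set.Ioi 0)) →
        ∀ g : Literature.Probability.RandomPlanarGeometry.ConformalRectangle → ℝ,
          (∀ R : Literature.Probability.RandomPlanarGeometry.ConformalRectangle,
            Filter.Tendsto (fun n => Literature.Probability.Percolation.bondDomainCrossingProb R (u n))
              Filter.atTop (nhds (g R))) →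
          ∃ G : ℝ → ℝ,
            ∀ (R : Literature.Probability.RandomPlanarGeometry.ConformalRectangle)
              (φ : Literature.Probability.RandomPlanarGeometry.ConformalEquiv
                UpperHalfPlane.upperHalfPlaneSet R.carrier)
              (x : Fin 4 → ℝ), R.IsUniformizing φ x →
              g R = G (Literature.Probability.RandomPlanarGeometry.crossRatio x)) :=
  ⟨stub_limitConformal_of_subseqConformalInvariance,
    subseqConformalInvariance_of_stub_limitConformal stub_countableApprox⟩

end Summit.CriticalPhenomena.CardyFormulaZ2.Cruxes.SubseqCardy.Birth
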